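import Summits.BirchSwinnertonDyer.Rank1Residual.GaloisImage.LocalIntegersNormalBasisLattice
import HarnessLib

/-!
# `#Hom_Δ(Z, 𝒪_E/p) = #Hom(Z, 𝒪_K/p)` and `#(𝒪_E/p) = #(𝒪_K/p)^{[E:K]}`: the normal-basis count
# (cell `b2b-bsdres`, team n1011, row T-EPC = Tate's local Euler–Poincaré characteristic; seat p04 GEN 8; stage B6b)

HONEST FRAMING (cell `b2b-bsdres`, run/shared/lean/b2b/bsd-rank1-residual/, verbatim in every
file): the goal of the cell is to DELETE the COMBINATION-SHAPED residual classes of the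
Birch–Swinnerton-Dyer formula for ALL analytic-rank `≤ 1` elliptic curves over `ℚ` — "full BSD
formula for every rank `≤ 1` curve in class `C`" assembled STRICTLY from published theorems — so
that the rank-`≤ 1` remainder becomes exactly the CONSTRUCTION-SHAPED classes, which are TYPED
(missing-input `Prop`s), NOT attempted. This is not "finishing BSD". Team n1011 (N10 / N11, the
additive block X4 ∧ `p = 3`): research route; no claim beyond the stated classes; nothing is
booked; no mark / label is changed by this file. Theorems only (no definition, no named fact, no
`sorry`); TOOL theorems on local fields.  (Placement: Summits/GaloisImage, as stages A1–B6a.)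

## What

`E/K` finite Galois, `E` a non-archimedean local field of characteristic `0` with `|p| < 1` whose
Galois group `Δ` preserves the valuation; `𝒪_K = K ∩ 𝒪_E` (membership-characterised
`ℤ`-submodule `OK` of `K`), `𝒪_E` the `ℤ`-submodule `O` of `E`.  From the normal-basis lattice
`p^N 𝒪_E ≤ L = ⊕_σ 𝒪_K σx ≤ 𝒪_E` (stage B6a) — packaged here as
`LocalIntegers.exists_normalBasis_submodule` (`L` is `Δ`-stable, freely generated over `Δ` by a copy
`Y₀ ≃ 𝒪_K` of `𝒪_K`, of finite `p`-power index in `𝒪_E`) — Milne's Lemma 2.12 (stage A3,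
`natCard_modP_eq_of_torsionFree_of_le`) and the free count modulo `p` (stage B6a):

* `LocalIntegers.natCard_intertwiningMap_modP_integer` — for `p ∤ #Δ` and `Z` finite with `pZ = 0`:
  **`#Hom_Δ(Z, 𝒪_E/p) = #Hom(Z, 𝒪_K/p)`**, and `…_eq_pow`: `= #(𝒪_K/p)^r` for `#Z = p^r`
  (Milne: "`[R_L^{(p)}] = [K:ℚ_p]·[𝔽_p[G]]`" in `R_{𝔽_p}(G)`, evaluated against `Z`);
* `LocalIntegers.natCard_integer_quotient_eq_pow` — **`#(𝒪_E/p) = #(𝒪_K/p)^{[E:K]}`** (any `Δ`;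
  Lemma 2.12 for the trivial group);
* `ModPRepCount.natCard_pi_quotient_range_lsmul` — `#((ι → M)/p) = #(M/p)^{#ι}`.

The assembled Lemma 2.11 (`#Hom_Δ(Z, Eˣ/p) = #(𝒪_K/p)^r · #Hom_Δ(Z, μ(E)[p]) · #Z^Δ`) is the
sequel (stage B7, `LocalUnitsModPMilneCount`).

References: J. S. Milne, *Arithmetic Duality Theorems*, 2nd ed. (2006), I §2, proof of Thm. 2.8,
Lemmas 2.11–2.12 (pp. 33–34) [MilneADT2006].
-/

noncomputable section

open Function
open scoped ValuativeRel

namespace Summit.BirchSwinnertonDyer.Rank1Residual.GaloisImage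

/-! ### `#((ι → M)/p) = #(M/p)^{#ι}` -/

namespace ModPRepCount

/-- `#((ι → M)/p(ι → M)) = #(M/pM)^{#ι}` for a finite index type `ι`: reduction modulo `p` is
coordinatewise. [folklore] -/
theorem natCard_pi_quotient_range_lsmul {ι M : Type*} [Finite ι] [AddCommGroup M] (p : ℕ) :
    Nat.card ((ι → M) ⧸ LinearMap.range (LinearMap.lsmul ℤ (ι → M) p)) =
      Nat.card (M ⧸ LinearMap.range (LinearMap.lsmul ℤ M p)) ^ Nat.card ι := by
  classical
  set P : Submodule ℤ M := LinearMap.range (LinearMap.lsmul ℤ M p) with hP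
  let π : (ι → M) →ₗ[ℤ] (ι → M ⧸ P) := LinearMap.pi fun i => P.mkQ ∘ₗ LinearMap.proj i
  have hπ : ∀ (f : ι → M) (i : ι), π f i = Submodule.Quotient.mk (f i) := fun f i => rfl
  have hsurj : Surjective π := fun g =>
    ⟨fun i => (g i).out, funext fun i => by rw [hπ]; exact Submodule.Quotient.mk_out (g i)⟩
  have hker : LinearMap.ker π = LinearMap.range (LinearMap.lsmul ℤ (ι → M) p) := by
    apply le_antisymm
    · intro f hf
      rw [LinearMap.mem_ker] at hf
      have hfi : ∀ i, ∃ m : M, (p : ℤ) • m = f i := fun i => by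
        have h := congrFun hf i
        rw [hπ, Pi.zero_apply, Submodule.Quotient.mk_eq_zero] at h
        obtain ⟨m, hm⟩ := h
        exact ⟨m, hm⟩
      choose g hg using hfi
      exact ⟨g, funext fun i => by rw [LinearMap.lsmul_apply, Pi.smul_apply, hg]⟩
    · rintro _ ⟨g, rfl⟩
      rw [LinearMap.mem_ker]
      funext i
      rw [hπ, LinearMap.lsmul_apply, Pi.smul_apply, Pi.zero_apply, Submodule.Quotient.mk_eq_zero]
      exact ⟨g i, rfl⟩
  let e : ((ι → M) ⧸ LinearMap.range (LinearMap.lsmul ℤ (ι → M) p)) ≃ₗ[ℤ] (ι → M ⧸ P) :=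
    (Submodule.quotEquivOfEq _ _ hker.symm).trans (π.quotKerEquivOfSurjective hsurj)
  rw [Nat.card_congr e.toEquiv, Nat.card_fun]

end ModPRepCount

/-! ### The normal-basis lattice as a free `Δ`-module inside `𝒪_E` -/

namespace LocalIntegers

open Representation

variable {K : Type*} [Field K] {E : Type*} [Field E] [Algebra K E] [ValuativeRel E]
  [TopologicalSpace E] [IsNonarchimedeanLocalField E]
variable (p : ℕ) [hp : Fact p.Prime] [FiniteDimensional K E] [IsGalois K E]

/-- **The normal-basis lattice as a `Δ`-module.**  For `E/K` finite Galois (`Δ = Gal(E/K)`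
preserving the valuation of the characteristic-`0` local field `E`, `|p| < 1`) there is a
`Δ`-stable subgroup `L ≤ 𝒪_E` with `p^N 𝒪_E ≤ L`, freely generated over `Δ` by a subgroup `Y₀`
(`(c_σ)_σ ↦ ∑_σ σ c_σ : Y₀^Δ → L` bijective) with `Y₀ ≃ 𝒪_K` — namely `L = ⊕_σ 𝒪_K σx`,
`Y₀ = 𝒪_K x` for an integral normal basis `(σx)_σ` (stage B6a `exists_normalBasis_lattice`).
[cite: MilneADT2006, I §2 proof of Thm 2.8 (p. 34)] -/
theorem exists_normalBasis_submodule [CharZero E] (hpv : ValuativeRel.valuation E p < 1)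
    (hσ : ∀ (σ : E ≃ₐ[K] E) (x : E), ValuativeRel.valuation E (σ x) = ValuativeRel.valuation E x)
    (O : Submodule ℤ E) (hO : ∀ x, x ∈ O ↔ x ∈ 𝒪[E])
    (OK : Submodule ℤ K) (hOK : ∀ a : K, a ∈ OK ↔ algebraMap K E a ∈ 𝒪[E]) :
    ∃ (L : Submodule ℤ E) (hL : ∀ σ, L ≤ L.comap (Representation.ofDistribMulAction ℤ (E ≃ₐ[K] E) E σ))
      (Y₀ : Submodule ℤ L) (Φ : ((E ≃ₐ[K] E) → Y₀) →+ L),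
      L ≤ O ∧ (∃ N : ℕ, ∀ y ∈ O, (p : ℤ) ^ N • y ∈ L) ∧
      (∀ c, Φ c = ∑ g : E ≃ₐ[K] E,
        (Representation.ofDistribMulAction ℤ (E ≃ₐ[K] E) E).subrepresentation L hL g (c g : L)) ∧
      Bijective Φ ∧ Nonempty (Y₀ ≃ₗ[ℤ] OK) := by
  classical
  set ρE := Representation.ofDistribMulAction ℤ (E ≃ₐ[K] E) E with hρE
  have hρE_apply : ∀ (σ : E ≃ₐ[K] E) (y : E), ρE σ y = σ y := fun σ y => rfl
  obtain ⟨x, hx, ⟨b, hb⟩, N, hN⟩ := exists_normalBasis_lattice p hpv hσ (K := K) (E := E)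
  have hx0 : x ≠ 0 := by
    have h := b.ne_zero 1
    rwa [hb, AlgEquiv.one_apply] at h
  -- `ι : 𝒪_K → E`, `a ↦ a x`
  let ι : OK →ₗ[ℤ] E :=
    { toFun := fun a => algebraMap K E (a : K) * x
      map_add' := fun a a' => by
        rw [Submodule.coe_add, map_add, add_mul]
      map_smul' := fun n a => by
        rw [Submodule.coe_smul_of_tower, RingHom.id_apply, map_zsmul, smul_mul_assoc] }
  have hι : ∀ a : OK, ι a = algebraMap K E (a : K) * x := fun a => rfl
  have hιinj : Injective ι := by
    intro a a' h
    rw [hι, hι] at h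
    exact Subtype.ext ((algebraMap K E).injective (mul_right_cancel₀ hx0 h))
  -- `Φ₀ : (c_σ) ↦ ∑ σ (c_σ x)`
  let Φ₀ : ((E ≃ₐ[K] E) → OK) →ₗ[ℤ] E := ∑ σ : E ≃ₐ[K] E, ρE σ ∘ₗ ι ∘ₗ LinearMap.proj σ
  have hΦ₀ : ∀ c, Φ₀ c = ∑ σ : E ≃ₐ[K] E, algebraMap K E (c σ : K) * σ x := fun c => by
    rw [LinearMap.coe_sum, Finset.sum_apply]
    refine Finset.sum_congr rfl fun σ _ => ?_
    rw [LinearMap.comp_apply, LinearMap.comp_apply, LinearMap.proj_apply, hι, hρE_apply, map_mul,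
      AlgEquiv.commutes]
  have hΦ₀' : ∀ c, Φ₀ c = ∑ σ : E ≃ₐ[K] E, σ (ι (c σ)) := fun c => by
    rw [LinearMap.coe_sum, Finset.sum_apply]; rfl
  set L : Submodule ℤ E := LinearMap.range Φ₀ with hLdef
  -- `ι a ∈ L`
  have hιL : ∀ a : OK, ι a ∈ L := fun a => by
    refine ⟨Pi.single 1 a, ?_⟩
    rw [hΦ₀', Finset.sum_eq_single (1 : E ≃ₐ[K] E)]
    · rw [Pi.single_eq_same, AlgEquiv.one_apply]
    · intro σ _ hσ1
      rw [Pi.single_eq_of_ne hσ1, map_zero, map_zero]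
    · intro h; exact absurd (Finset.mem_univ _) h
  -- `Δ`-stability
  have hL : ∀ τ, L ≤ L.comap (ρE τ) := by
    rintro τ _ ⟨c, rfl⟩
    rw [Submodule.mem_comap, hρE_apply, hΦ₀', map_sum]
    refine ⟨fun σ => c (τ⁻¹ * σ), ?_⟩
    rw [hΦ₀']
    refine (Fintype.sum_equiv (Equiv.mulLeft τ) (fun σ => τ (σ (ι (c σ))))
      (fun σ => σ (ι (c (τ⁻¹ * σ)))) fun σ => ?_).symm
    change τ (σ (ι (c σ))) = (τ * σ) (ι (c (τ⁻¹ * (τ * σ))))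
    rw [inv_mul_cancel_left, AlgEquiv.mul_apply]
  have hLO : L ≤ O := by
    rintro _ ⟨c, rfl⟩
    rw [hO, hΦ₀]
    exact Subring.sum_mem _ fun σ _ =>
      Subring.mul_mem _ ((hOK _).1 (c σ).2) (OneUnits.map_mem_integer (hσ σ) hx)
  have hpN : ∀ y ∈ O, (p : ℤ) ^ N • y ∈ L := by
    intro y hy
    obtain ⟨a, ha, hay⟩ := hN y ((hO y).1 hy)
    refine ⟨fun σ => ⟨a σ, (hOK _).2 (ha σ)⟩, ?_⟩
    rw [zsmul_eq_mul, Int.cast_pow, Int.cast_natCast, hay, hΦ₀]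
  -- the subrepresentation on `L` and `Y₀ = 𝒪_K x`
  set ρL := ρE.subrepresentation L hL with hρL
  have hρL_coe : ∀ (σ : E ≃ₐ[K] E) (y : L), ((ρL σ y : L) : E) = σ (y : E) := fun σ y => rfl
  have hXL : LinearMap.range ι ≤ L := by
    rintro _ ⟨a, rfl⟩; exact hιL a
  set Y₀ : Submodule ℤ L := (LinearMap.range ι).comap L.subtype with hY₀
  have hY₀ : ∀ y : Y₀, ∃ a : OK, ι a = ((y : L) : E) := fun y => y.2
  let Φ : ((E ≃ₐ[K] E) → Y₀) →+ L :=
    { toFun := fun c => ∑ g : E ≃ₐ[K] E, ρL g (c g : L)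
      map_zero' := by simp
      map_add' := fun c c' => by
        simp only [Pi.add_apply, Submodule.coe_add, map_add, Finset.sum_add_distrib] }
  have hΦ : ∀ c, Φ c = ∑ g : E ≃ₐ[K] E, ρL g (c g : L) := fun c => rfl
  have hΦcoe : ∀ c, ((Φ c : L) : E) = ∑ g : E ≃ₐ[K] E, g (((c g : L) : E)) := fun c => by
    rw [hΦ, Submodule.coe_sum]
    exact Finset.sum_congr rfl fun g _ => hρL_coe g _
  refine ⟨L, hL, Y₀, Φ, hLO, ⟨N, hpN⟩, hΦ, ⟨?_, ?_⟩,
    ⟨(Submodule.comapSubtypeEquivOfLe hXL).trans (LinearEquiv.ofInjective ι hιinj).symm⟩⟩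
  · -- injectivity: linear independence of `(σx)_σ` over `K`
    rw [injective_iff_map_eq_zero]
    intro c hc
    choose a ha using fun g => hY₀ (c g)
    have hsum : ∑ σ : E ≃ₐ[K] E, (a σ : K) • b σ = 0 := by
      have h0 : ((Φ c : L) : E) = 0 := by rw [hc, Submodule.coe_zero]
      rw [hΦcoe] at h0
      rw [← h0]
      refine Finset.sum_congr rfl fun σ _ => ?_
      rw [hb, ← ha, hι, map_mul, AlgEquiv.commutes, Algebra.smul_def]
    have ha0 := Fintype.linearIndependent_iff.1 b.linearIndependent (fun σ => (a σ : K)) hsum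
    funext σ
    apply Subtype.ext
    apply Subtype.ext
    rw [← ha]
    change ι (a σ) = ((0 : L) : E)
    rw [Submodule.coe_zero, hι, ha0 σ, map_zero, zero_mul]
  · -- surjectivity
    rintro ⟨_, ⟨d, rfl⟩⟩
    have hmem : ∀ σ, (⟨ι (d σ), hιL (d σ)⟩ : L) ∈ Y₀ := fun σ => ⟨d σ, rfl⟩
    refine ⟨fun σ => ⟨⟨ι (d σ), hιL (d σ)⟩, hmem σ⟩, Subtype.ext ?_⟩
    change ((Φ _ : L) : E) = Φ₀ d
    rw [hΦcoe, hΦ₀']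

/-! ### `#Hom_Δ(Z, 𝒪_E/p) = #Hom(Z, 𝒪_K/p)` -/

/-- **`#Hom_Δ(Z, 𝒪_E/p𝒪_E) = #Hom(Z, 𝒪_K/p𝒪_K)`** for `E/K` finite Galois with `Δ = Gal(E/K)` of
order prime to `p` preserving the valuation of the characteristic-`0` local field `E` (`|p| < 1`),
and every finite `Δ`-module `Z` killed by `p`: Milne's "`[R_L^{(p)}] = [K:ℚ_p][𝔽_p[G]]`"
evaluated against `Z` — Lemma 2.12 (stage A3) moves from `𝒪_E` to the normal-basis lattice
`⊕_σ 𝒪_K σx`, which is free over `Δ` on `𝒪_K x ≃ 𝒪_K` (stage B6a).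
[cite: MilneADT2006, I §2 proof of Thm 2.8 (Lemma 2.12 and the normal basis theorem, p. 34)] -/
theorem natCard_intertwiningMap_modP_integer [CharZero E] (hpv : ValuativeRel.valuation E p < 1)
    (hσ : ∀ (σ : E ≃ₐ[K] E) (x : E), ValuativeRel.valuation E (σ x) = ValuativeRel.valuation E x)
    (hG : ¬ p ∣ Nat.card (E ≃ₐ[K] E))
    {Z : Type*} [AddCommGroup Z] [Finite Z] (σZ : Representation ℤ (E ≃ₐ[K] E) Z)
    (hZ : ∀ z : Z, p • z = 0)
    (O : Submodule ℤ E) (hO : ∀ x, x ∈ O ↔ x ∈ 𝒪[E])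
    (hOst : ∀ σ, O ≤ O.comap (Representation.ofDistribMulAction ℤ (E ≃ₐ[K] E) E σ))
    (OK : Submodule ℤ K) (hOK : ∀ a : K, a ∈ OK ↔ algebraMap K E a ∈ 𝒪[E]) :
    Nat.card (IntertwiningMap σZ ((((Representation.ofDistribMulAction ℤ (E ≃ₐ[K] E) E).subrepresentation
        O hOst).quotient _ (ModPRepCount.range_lsmul_le_comap
          ((Representation.ofDistribMulAction ℤ (E ≃ₐ[K] E) E).subrepresentation O hOst) p)))) =
      Nat.card (Z →+ (OK ⧸ LinearMap.range (LinearMap.lsmul ℤ OK p))) := by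
  classical
  set ρE := Representation.ofDistribMulAction ℤ (E ≃ₐ[K] E) E with hρE
  obtain ⟨L, hL, Y₀, Φ, hLO, ⟨N, hpN⟩, hΦ, hbij, ⟨eY⟩⟩ :=
    exists_normalBasis_submodule p hpv hσ O hO OK hOK
  -- finiteness of `𝒪_E/p`
  haveI : Finite (𝒪[E] ⧸ Ideal.span {(p : 𝒪[E])}) := by
    obtain ⟨U₂, hU₂⟩ := OneUnits.exists_submodule p hpv (by norm_num : 1 ≤ 2) (E := E)
    exact (OneUnits.natCard_quotient_two_eq p hpv U₂ hU₂).2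
  haveI : Finite (O ⧸ LinearMap.range (LinearMap.lsmul ℤ O p)) :=
    Nat.finite_of_card_ne_zero (by
      rw [OneUnits.natCard_quotient_integer_eq p O hO]; exact Nat.card_pos.ne')
  have htf : ∀ v : E, (p : ℤ) • v = 0 → v = 0 := fun v hv =>
    (smul_eq_zero.1 hv).resolve_left (by exact_mod_cast hp.out.ne_zero)
  -- Lemma 2.12: `𝒪_E ↝ L`
  have h1 := (ModPRepCount.natCard_modP_eq_of_torsionFree_of_le ρE σZ hG hZ htf O hOst N L hL hLO
    hpN).2
  rw [h1, ModPRepCount.natCard_intertwiningMap_modP_of_free σZ _ p Y₀ Φ hΦ hbij]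
  -- `Y₀ ≃ 𝒪_K`
  let e : (Y₀ ⧸ LinearMap.range (LinearMap.lsmul ℤ Y₀ p)) ≃ₗ[ℤ]
      (OK ⧸ LinearMap.range (LinearMap.lsmul ℤ OK p)) :=
    Submodule.Quotient.equiv _ _ eY (OneUnits.map_range_lsmul_eq p eY)
  exact Nat.card_congr
    { toFun := fun h => e.toLinearMap.toAddMonoidHom.comp h
      invFun := fun h => e.symm.toLinearMap.toAddMonoidHom.comp h
      left_inv := fun h => AddMonoidHom.ext fun z => e.symm_apply_apply (h z)
      right_inv := fun h => AddMonoidHom.ext fun z => e.apply_symm_apply (h z) }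

/-- **`#Hom_Δ(Z, 𝒪_E/p𝒪_E) = #(𝒪_K/p𝒪_K)^r`** for `#Z = p^r` (same hypotheses). This is the term
`[R^{(p)}]` of Milne's Lemma 2.11, counted. [cite: MilneADT2006, I §2 Lemma 2.11 (p. 33)] -/
theorem natCard_intertwiningMap_modP_integer_eq_pow [CharZero E] (hpv : ValuativeRel.valuation E p < 1)
    (hσ : ∀ (σ : E ≃ₐ[K] E) (x : E), ValuativeRel.valuation E (σ x) = ValuativeRel.valuation E x)
    (hG : ¬ p ∣ Nat.card (E ≃ₐ[K] E))
    {Z : Type*} [AddCommGroup Z] [Finite Z] (σZ : Representation ℤ (E ≃ₐ[K] E) Z)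
    (hZ : ∀ z : Z, p • z = 0) {r : ℕ} (hcard : Nat.card Z = p ^ r)
    (O : Submodule ℤ E) (hO : ∀ x, x ∈ O ↔ x ∈ 𝒪[E])
    (hOst : ∀ σ, O ≤ O.comap (Representation.ofDistribMulAction ℤ (E ≃ₐ[K] E) E σ))
    (OK : Submodule ℤ K) (hOK : ∀ a : K, a ∈ OK ↔ algebraMap K E a ∈ 𝒪[E]) :
    Nat.card (IntertwiningMap σZ ((((Representation.ofDistribMulAction ℤ (E ≃ₐ[K] E) E).subrepresentation
        O hOst).quotient _ (ModPRepCount.range_lsmul_le_comap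
          ((Representation.ofDistribMulAction ℤ (E ≃ₐ[K] E) E).subrepresentation O hOst) p)))) =
      Nat.card (OK ⧸ LinearMap.range (LinearMap.lsmul ℤ OK p)) ^ r := by
  rw [natCard_intertwiningMap_modP_integer p hpv hσ hG σZ hZ O hO hOst OK hOK]
  refine ModPRepCount.natCard_addMonoidHom_of_card_eq_pow hZ (fun a => ?_) hcard
  obtain ⟨a, rfl⟩ := Submodule.mkQ_surjective _ a
  rw [← map_nsmul, Submodule.mkQ_apply, Submodule.Quotient.mk_eq_zero]
  exact ⟨a, by rw [LinearMap.lsmul_apply, natCast_zsmul]⟩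

/-! ### `#(𝒪_E/p) = #(𝒪_K/p)^{[E:K]}` -/

/-- **`#(𝒪_E/p𝒪_E) = #(𝒪_K/p𝒪_K)^{[E:K]}`** for `E/K` finite Galois with `Gal(E/K)` preserving the
valuation of the characteristic-`0` local field `E` (`|p| < 1`; no hypothesis on `#Gal(E/K)`):
`#(𝒪_E/p) = #(L/pL)` for the normal-basis lattice `L ≅ 𝒪_K^{[E:K]}` (Lemma 2.12 for the trivial
group, stage A3). [cite: MilneADT2006, I §2 proof of Thm 2.8 (Lemma 2.12, p. 34)] -/
theorem natCard_integer_quotient_eq_pow [CharZero E] (hpv : ValuativeRel.valuation E p < 1)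
    (hσ : ∀ (σ : E ≃ₐ[K] E) (x : E), ValuativeRel.valuation E (σ x) = ValuativeRel.valuation E x)
    (OK : Submodule ℤ K) (hOK : ∀ a : K, a ∈ OK ↔ algebraMap K E a ∈ 𝒪[E]) :
    Nat.card (𝒪[E] ⧸ Ideal.span {(p : 𝒪[E])}) =
      Nat.card (OK ⧸ LinearMap.range (LinearMap.lsmul ℤ OK p)) ^ Module.finrank K E := by
  classical
  obtain ⟨O, hO⟩ := exists_submodule_integer (E := E)
  obtain ⟨L, hL, Y₀, Φ, hLO, ⟨N, hpN⟩, hΦ, hbij, ⟨eY⟩⟩ :=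
    exists_normalBasis_submodule p hpv hσ O hO OK hOK
  haveI : Finite (𝒪[E] ⧸ Ideal.span {(p : 𝒪[E])}) := by
    obtain ⟨U₂, hU₂⟩ := OneUnits.exists_submodule p hpv (by norm_num : 1 ≤ 2) (E := E)
    exact (OneUnits.natCard_quotient_two_eq p hpv U₂ hU₂).2
  haveI hfinO : Finite (O ⧸ LinearMap.range (LinearMap.lsmul ℤ O p)) :=
    Nat.finite_of_card_ne_zero (by
      rw [OneUnits.natCard_quotient_integer_eq p O hO]; exact Nat.card_pos.ne')
  have htf : ∀ v : E, (p : ℤ) • v = 0 → v = 0 := fun v hv =>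
    (smul_eq_zero.1 hv).resolve_left (by exact_mod_cast hp.out.ne_zero)
  rw [← OneUnits.natCard_quotient_integer_eq p O hO]
  -- Lemma 2.12 for the trivial group `Unit`: `#(O/p) = #(L/p)` through `#Hom_1(ℤ/p, ·)`
  let ρ₁ : Representation ℤ Unit E := Representation.trivial ℤ Unit E
  let σ₁ : Representation ℤ Unit (ZMod p) := Representation.trivial ℤ Unit (ZMod p)
  have h1G : ¬ p ∣ Nat.card Unit := by
    rw [Nat.card_unique, Nat.dvd_one]; exact hp.out.ne_one
  have hZ₁ : ∀ z : ZMod p, p • z = 0 := fun z => by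
    rw [nsmul_eq_mul, ZMod.natCast_self, zero_mul]
  have hO₁ : ∀ g, O ≤ O.comap (ρ₁ g) := fun _ y hy => hy
  have hL₁ : ∀ g, L ≤ L.comap (ρ₁ g) := fun _ y hy => hy
  obtain ⟨hfinL, h12⟩ := ModPRepCount.natCard_modP_eq_of_torsionFree_of_le ρ₁ σ₁ h1G hZ₁ htf O hO₁
    N L hL₁ hLO hpN
  -- `#Hom_1(ℤ/p, T) = #T` for `pT = 0`
  have hcount : ∀ {T : Type _} [AddCommGroup T] [Finite T] (τ : Representation ℤ Unit T),
      (∀ g t, τ g t = t) → (∀ t : T, p • t = 0) →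
      Nat.card (IntertwiningMap σ₁ τ) = Nat.card T := by
    intro T _ _ τ hτ hT
    rw [ModPRepCount.natCard_intertwiningMap_trivial σ₁ h1G τ hτ hZ₁]
    have etop : σ₁.invariants ≃ₗ[ℤ] ZMod p :=
      LinearEquiv.ofTop _ (eq_top_iff.2 fun z _ g => rfl)
    have e1 : (σ₁.invariants →+ T) ≃ (ZMod p →+ T) :=
      { toFun := fun h => h.comp etop.symm.toLinearMap.toAddMonoidHom
        invFun := fun h => h.comp etop.toLinearMap.toAddMonoidHom
        left_inv := fun h => AddMonoidHom.ext fun z => congrArg h (etop.symm_apply_apply z)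
        right_inv := fun h => AddMonoidHom.ext fun z => congrArg h (etop.apply_symm_apply z) }
    rw [Nat.card_congr e1, ModPRepCount.natCard_addMonoidHom_of_card_eq_pow (r := 1) hZ₁ hT
      (by rw [Nat.card_zmod, pow_one]), pow_one]
  have hmodO : ∀ t : O ⧸ LinearMap.range (LinearMap.lsmul ℤ O p), p • t = 0 := fun t => by
    obtain ⟨a, rfl⟩ := Submodule.mkQ_surjective _ t
    rw [← map_nsmul, Submodule.mkQ_apply, Submodule.Quotient.mk_eq_zero]
    exact ⟨a, by rw [LinearMap.lsmul_apply, natCast_zsmul]⟩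
  have hmodL : ∀ t : L ⧸ LinearMap.range (LinearMap.lsmul ℤ L p), p • t = 0 := fun t => by
    obtain ⟨a, rfl⟩ := Submodule.mkQ_surjective _ t
    rw [← map_nsmul, Submodule.mkQ_apply, Submodule.Quotient.mk_eq_zero]
    exact ⟨a, by rw [LinearMap.lsmul_apply, natCast_zsmul]⟩
  haveI := hfinL
  have eqO := hcount ((ρ₁.subrepresentation O hO₁).quotient _
      (ModPRepCount.range_lsmul_le_comap (ρ₁.subrepresentation O hO₁) p))
    (fun g t => by obtain ⟨a, rfl⟩ := Submodule.mkQ_surjective _ t; rfl) hmodO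
  have eqL := hcount ((ρ₁.subrepresentation L hL₁).quotient _
      (ModPRepCount.range_lsmul_le_comap (ρ₁.subrepresentation L hL₁) p))
    (fun g t => by obtain ⟨a, rfl⟩ := Submodule.mkQ_surjective _ t; rfl) hmodL
  have hOL : Nat.card (O ⧸ LinearMap.range (LinearMap.lsmul ℤ O p)) =
      Nat.card (L ⧸ LinearMap.range (LinearMap.lsmul ℤ L p)) := eqO.symm.trans (h12.trans eqL)
  rw [hOL]
  -- `L ≃ 𝒪_K^Δ`
  let eL : L ≃ₗ[ℤ] ((E ≃ₐ[K] E) → OK) :=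
    ((AddEquiv.ofBijective Φ hbij).toIntLinearEquiv.symm).trans (LinearEquiv.piCongrRight fun _ => eY)
  let eQ : (L ⧸ LinearMap.range (LinearMap.lsmul ℤ L p)) ≃ₗ[ℤ]
      (((E ≃ₐ[K] E) → OK) ⧸ LinearMap.range (LinearMap.lsmul ℤ ((E ≃ₐ[K] E) → OK) p)) :=
    Submodule.Quotient.equiv _ _ eL (OneUnits.map_range_lsmul_eq p eL)
  rw [Nat.card_congr eQ.toEquiv, ModPRepCount.natCard_pi_quotient_range_lsmul,
    IsGalois.card_aut_eq_finrank]

end LocalIntegers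

end Summit.BirchSwinnertonDyer.Rank1Residual.GaloisImage

end
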